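import Summits.ValiantsHypothesis.ValiantsHypothesis.Theorems.KPlusLogSqLawLiftingRungFourRange
import Summits.ValiantsHypothesis.ValiantsHypothesis.Theorems.KPlusLogSqLawTropicalShiftSquareChain

/-!
# Route «KPlusLogSqLaw», crux `Lifting` — the `K = 4` rung on the range `m ≤ 12283` (Descartes + SHIFT-SQUARE)

HONEST FRAMING.  Helper (partial range, no stub credit) toward the aside crux
`Summit.ValiantsHypothesis.ValiantsHypothesis.Theses.KPlusLogSqLaw.Lifting` (item `stmt-ValiantsHypothesis-19772`) and its weak form
`WeakLifting` (item `stmt-ValiantsHypothesis-19561`, route `KPlusLogSqLaw`, cell `pub-symmetroid`; seat val-sym-lift-p3 g7, 2026-08-27).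
The tree's `lift_rung_four_of_le` (p427828, this seat's g0) gives the `K = 4` analogue of the landed BC5 rung `stub_liftRungThree` on the range
`m + 3 ≤ 3072`, from the QUADRATIC tropical floor `C(m+2,2) − 2 ≤ T(m,4)` (SHIFT-THREE).  Since then the kernel floor of the `K = 4` tropical
row improved to `(m+1)² − 1 ≤ T(m,4)` for every `m` (SHIFT-SQUARE, `TropicalCensus.sq_sub_one_le_of_tropRootLawAt_four`, val-sym-trop-p5 g8,
p-id in the tree history); against the cubic real Descartes ceiling `2·C(m+3,3) − 1 = (m+3)(m+2)(m+1)/3 − 1` the constant `2^12` now absorbs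
`(m+3)(m+2) ≤ 3·2^12·(m+1)`, i.e. the rung holds for ALL `m ≤ 12283` (`lift_rung_four_of_le_sq`) — four times the previous range, same constant.
HONEST READING: still a bounded-`m` statement; the all-`m` rung at `K = 4` needs a cubic tropical family or a sub-Descartes real bound (the
cell's open `K = 4` fork, `TropK4Law 2`), exactly as recorded in `…LiftingRungFourRange`.  Nothing here asserts `Lifting`, `WeakLifting`,
`TropicalB`, `KPlusLogSqLaw`, `MatrixDescartes` (stmt-ValiantsHypothesis-18050) or anything about `VP ≠ VNP`.
[folklore] (Descartes' rule + arithmetic).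
-/

set_option linter.dupNamespace false
set_option autoImplicit false

namespace Summit.ValiantsHypothesis.ValiantsHypothesis.Theorems.KPlusLogSqLaw

open Summit.ValiantsHypothesis.ValiantsHypothesis.Theorems.LacunarySymmetroidMatrixDescartes (RealRootLawAt)
open Summit.ValiantsHypothesis.ValiantsHypothesis.Theorems.LacunarySymmetroidMatrixDescartes.TropicalCensus (TropRootLawAt)

/-- `6·C(m+3,3) = (m+3)(m+2)(m+1)`. [folklore] -/
theorem six_mul_choose_three (m : ℕ) : 6 * (m + 3).choose 3 = (m + 3) * (m + 2) * (m + 1) := by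
  have h1 := three_mul_choose_three m
  have h2 : (m + 2).choose 2 * 2 = (m + 2) * (m + 1) := by
    rw [Nat.choose_two_right]
    have h3 : (m + 2) * (m + 2 - 1) = (m + 2) * (m + 1) := by rw [show m + 2 - 1 = m + 1 from rfl]
    rw [h3]
    exact Nat.div_mul_cancel (by
      rcases Nat.even_or_odd m with ⟨k, hk⟩ | ⟨k, hk⟩
      · exact ⟨(k + 1) * (m + 1), by rw [hk]; ring⟩
      · exact ⟨(m + 2) * (k + 1), by rw [hk]; ring⟩)
  nlinarith [h1, h2]

/-- **LIFT, rung `K = 4`, on the range `m ≤ 12283` (constant `2^12`):** there the quadratic tropical floor `(m+1)² − 1 ≤ n`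
(SHIFT-SQUARE) and the cubic real Descartes ceiling `2·C(m+3,3) − 1` still fit under `2^12·(n+1)`. [folklore] -/
theorem lift_rung_four_of_le_sq (m n : ℕ) (hm : m ≤ 12283) (h : TropRootLawAt m 4 n) :
    RealRootLawAt m 4 (2 ^ (3 * 4) * (n + 1)) := by
  have h1 := LacunarySymmetroidMatrixDescartes.TropicalCensus.sq_sub_one_le_of_tropRootLawAt_four m n h
  refine LacunarySymmetroidMatrixDescartes.Census.realRootLawAt_mono ?_
    (LacunarySymmetroidMatrixDescartes.Census.realRootLawAt_descartes m 4 (by norm_num))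
  have h2 : Nat.choose (m + 4 - 1) m = Nat.choose (m + 3) 3 := by
    rw [show m + 4 - 1 = m + 3 from rfl]
    exact Nat.choose_symm_add
  have h3 := six_mul_choose_three m
  have h4 : (m + 1) ^ 2 ≤ n + 1 := by
    have : 1 ≤ (m + 1) ^ 2 := Nat.one_le_pow _ _ (Nat.succ_pos m)
    omega
  rw [h2, show 2 ^ (3 * 4) = 4096 by norm_num]
  -- `6·(2·C − 1) < 6·2·C = 2(m+3)(m+2)(m+1) ≤ 6·4096·(m+1)² ≤ 6·4096·(n+1)` since `(m+3)(m+2) ≤ 12288(m+1)` for `m ≤ 12283`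
  have h5 : (m + 3) * (m + 2) ≤ 12288 * (m + 1) := by nlinarith
  have h6 : 2 * (m + 3).choose 3 ≤ 4096 * (m + 1) ^ 2 := by nlinarith
  have h7 : 4096 * (m + 1) ^ 2 ≤ 4096 * (n + 1) := Nat.mul_le_mul_left _ h4
  omega

end Summit.ValiantsHypothesis.ValiantsHypothesis.Theorems.KPlusLogSqLaw
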